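import Mathlib
import HarnessLib
import Summits.NavierStokesRegularity.NavierStokesRegularity.Theorems.QuarterLogPincerHelmholtzCentreNearField
import Summits.NavierStokesRegularity.NavierStokesRegularity.Theorems.QuarterLogPincerSilencingCostKernel
import Summits.NavierStokesRegularity.NavierStokesRegularity.Theorems.QuarterLogPincerSmoothSilenceKernel
import Literature.Analysis.FluidPDE.LocalBiotSavartHelmholtz
import Literature.Analysis.FluidPDE.BiotSavartBounds
import Literature.Analysis.FluidPDE.TaoEnstrophyLocalisation

/-!
# Route `QuarterLogPincer`, crux `TypeIQuantSubcubicExp` (stmt-NavierStokesRegularity-24077), line `vortical_centre` —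
# the line's PROVED KERNEL by name: Sb `VorticalCentre` ⟸ H1 + H2, H2 ⟸ H2♭, hence Sb ⟸ H2♭; E2 products

VERBATIM port (bodies byte-identical) of the sorry-free theorems of `Cruxes/TypeIQuantSubcubicExp/Lines/vortical_centre.lean` (v1.2, tree sha16
51dbd9e0ddc6fe01; idea-crit-4 PASS incl. H2♭, HOURLY-5 10:04Z): `setIntegral_norm_le_sqrt_vol_mul_sqrt` (Cauchy–Schwarz on a finite-measure set),
`harmonicRemainder_of_shellKernelBound : ShellKernelBound → HarmonicRemainder` (H2 ⟸ H2♭), ★ `vorticalCentre_of_stubs : HelmholtzNearField →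
HarmonicRemainder → SilencingCost.VorticalCentre` (the kernel: Sb from H1 + H2), `vorticalCentre_of_harmonicRemainder` (Sb ⟸ H2; H1 is the theorem
`helmholtzNearField_holds` of `…HelmholtzCentreNearField`), `vorticalCentre_of_shellKernelBound` (Sb ⟸ H2♭), and the E2 products over the tree kernels
`terminalEmber_of_aftermath_of_shellKernel_of_thickBox : RegularAftermath → ShellKernelBound → ThickBoxSilencingCost → TerminalEmber` (via
`SilencingCost.terminalEmber_of_aftermath_of_vortical_of_thickBox`), `terminalEmber_of_sharp_of_shellKernel : SharpAftermath → ShellKernelBound →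
SharpEnstrophyPersistence → EmberReadout → TerminalEmber` (via `SmoothSilence.terminalEmber_of_sharp`).  NOT ported: `stub_shellKernelBound` (the
line's one sorry), `stub_harmonicRemainder`, `vorticalCentre_via_stubs`.  HONEST FRAME: linear potential theory + composition of landed implications;
H2♭ (hence H2, Sb) OPEN; nothing here bears on 24077's truth, W7 or Navier–Stokes regularity (OPEN / not proved).  pub-ns-dss typer (g38),
`--supports stmt-NavierStokesRegularity-24077`; bodies by ns-idea-7 (g13).
-/

set_option linter.dupNamespace false

noncomputable section

open MeasureTheory Set Function Filter Topology Metric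
open scoped ENNReal NNReal
open Literature.Analysis Literature.Analysis.FluidPDE

namespace Summit.NavierStokesRegularity.NavierStokesRegularity.Cruxes.TypeIQuantSubcubicExp.HelmholtzCentre

open Summit.NavierStokesRegularity.NavierStokesRegularity.Cruxes.TypeIQuantSubcubicExp.SilencingCost
  (VorticalCentre RegularAftermath)
open Summit.NavierStokesRegularity.NavierStokesRegularity.Cruxes.TypeIQuantSubcubicExp.EmberCensus (TerminalEmber)
open Summit.NavierStokesRegularity.NavierStokesRegularity.Cruxes.TypeIQuantSubcubicExp.LimitSilence
  (ThickBoxSilencingCost)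
open Summit.NavierStokesRegularity.NavierStokesRegularity.Cruxes.TypeIQuantSubcubicExp.SmoothSilence
  (SharpAftermath SharpEnstrophyPersistence)

/-- Cauchy–Schwarz on a ball of `ℝ³` (used for H2♭ → H2): `∫_{B(y,R)}‖f‖ ≤ √(|B₁|R³)·√W` when
`∫_{B(y,R)}‖f‖² ≤ W`. -/
theorem setIntegral_norm_le_sqrt_vol_mul_sqrt
    {f : (EuclideanSpace ℝ (Fin 3)) → (EuclideanSpace ℝ (Fin 3))} (hf : Continuous f)
    {y : EuclideanSpace ℝ (Fin 3)} {R W : ℝ} (hR : 0 < R)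
    (hW : ∫⁻ x in ball y R, ‖f x‖ₑ ^ 2 ≤ ENNReal.ofReal W) (hW0 : 0 ≤ W) :
    ∫ x in ball y R, ‖f x‖ ≤
      Real.sqrt ((volume (ball (0 : EuclideanSpace ℝ (Fin 3)) 1)).toReal * R ^ 3) * Real.sqrt W := by
  have h1 : ∫ x in ball y R, ‖f x‖ = (∫⁻ x in ball y R, ‖f x‖ₑ).toReal := by
    rw [integral_eq_lintegral_of_nonneg_ae (Eventually.of_forall fun x => norm_nonneg _)
      hf.norm.aestronglyMeasurable]
    simp_rw [ofReal_norm]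
  have hpq : Real.HolderConjugate 2 2 := ⟨by norm_num, by norm_num, by norm_num⟩
  have h4 := ENNReal.lintegral_mul_le_Lp_mul_Lq (volume.restrict (ball y R)) hpq
    (f := fun _ => (1 : ℝ≥0∞)) (g := fun x => ‖f x‖ₑ) aemeasurable_const hf.enorm.aemeasurable
  have h4' : ∫⁻ x in ball y R, ‖f x‖ₑ ≤
      (volume (ball y R)) ^ (1 / 2 : ℝ) * (∫⁻ x in ball y R, ‖f x‖ₑ ^ 2) ^ (1 / 2 : ℝ) := by
    have e1 : ((fun _ => (1 : ℝ≥0∞)) * fun x => ‖f x‖ₑ) = fun x => ‖f x‖ₑ := by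
      funext x; simp
    have e2 : ∫⁻ _ in ball y R, (1 : ℝ≥0∞) ^ (2 : ℝ) = volume (ball y R) := by
      rw [ENNReal.one_rpow, setLIntegral_const, one_mul]
    have e3 : (fun x => ‖f x‖ₑ ^ (2 : ℝ)) = fun x => ‖f x‖ₑ ^ 2 := by
      funext x; exact ENNReal.rpow_two _
    rw [e1, e2, e3] at h4
    exact h4
  have hvol : volume (ball y R) = ENNReal.ofReal (R ^ 3) * volume (ball (0 : EuclideanSpace ℝ (Fin 3)) 1) := by
    rw [Measure.addHaar_ball_of_pos _ _ hR, finrank_euclideanSpace, Fintype.card_fin]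
  have hvol_top : volume (ball y R) ≠ ⊤ := measure_ball_lt_top.ne
  have h5 : ∫⁻ x in ball y R, ‖f x‖ₑ ≤
      (volume (ball y R)) ^ (1 / 2 : ℝ) * (ENNReal.ofReal W) ^ (1 / 2 : ℝ) := by
    refine h4'.trans ?_
    gcongr
  have htop : (volume (ball y R)) ^ (1 / 2 : ℝ) * (ENNReal.ofReal W) ^ (1 / 2 : ℝ) ≠ ⊤ := by
    refine ENNReal.mul_ne_top ?_ ?_
    · exact ENNReal.rpow_ne_top_of_nonneg (by norm_num) hvol_top
    · exact ENNReal.rpow_ne_top_of_nonneg (by norm_num) ENNReal.ofReal_ne_top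
  have h6 := ENNReal.toReal_mono htop h5
  rw [ENNReal.toReal_mul, ← ENNReal.toReal_rpow, ← ENNReal.toReal_rpow, ENNReal.toReal_ofReal hW0, hvol,
    ENNReal.toReal_mul, ENNReal.toReal_ofReal (by positivity)] at h6
  rw [h1, Real.sqrt_eq_rpow, Real.sqrt_eq_rpow,
    show (volume (ball (0 : EuclideanSpace ℝ (Fin 3)) 1)).toReal * R ^ 3
      = R ^ 3 * (volume (ball (0 : EuclideanSpace ℝ (Fin 3)) 1)).toReal by ring]
  exact h6

/-- **H2 ⟸ H2♭ (v1.2, PROVED):** Cauchy–Schwarz `R⁻³∫_{B_R}‖v‖ ≤ √|B₁|·√(E/R³)`, `R⁻²∫_{B_R}‖curl v‖ ≤ √|B₁|·√(W/R)`. -/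
theorem harmonicRemainder_of_shellKernelBound (h : ShellKernelBound) : HarmonicRemainder := by
  obtain ⟨C, hC1, hC⟩ := h
  have hC0 : 0 ≤ C := by linarith
  set V₁ : ℝ := (volume (ball (0 : EuclideanSpace ℝ (Fin 3)) 1)).toReal with hV₁
  have hV₁0 : 0 ≤ V₁ := ENNReal.toReal_nonneg
  refine ⟨max 1 (C * Real.sqrt V₁), le_max_left _ _, ?_⟩
  intro v hv hdiv y R E W hR hE hE0 hW hW0
  have hR0 : R ≠ 0 := hR.ne'
  have hcurl_cont : Continuous (curl v) := by
    rw [curl_eq_curlCLM_comp]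
    exact curlCLM.continuous.comp (hv.continuous_fderiv (by norm_num))
  have hE' : ∫⁻ x in ball y R, ‖v x‖ₑ ^ 2 ≤ ENNReal.ofReal E := by
    have e : (fun x => ENNReal.ofReal (‖v x‖ ^ 2)) = fun x => ‖v x‖ₑ ^ 2 := by
      funext x; rw [ENNReal.ofReal_pow (norm_nonneg _), ofReal_norm]
    rw [e] at hE
    exact hE
  have hIv := setIntegral_norm_le_sqrt_vol_mul_sqrt hv.continuous hR hE' hE0
  have hIw := setIntegral_norm_le_sqrt_vol_mul_sqrt hcurl_cont hR hW hW0
  have e1 : (R ^ 3)⁻¹ * (Real.sqrt (V₁ * R ^ 3) * Real.sqrt E) = Real.sqrt V₁ * Real.sqrt (E / R ^ 3) := by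
    have hs : Real.sqrt (R ^ 3) * Real.sqrt (R ^ 3) = R ^ 3 := Real.mul_self_sqrt (by positivity)
    have hs0 : 0 < Real.sqrt (R ^ 3) := Real.sqrt_pos.mpr (by positivity)
    rw [Real.sqrt_mul hV₁0, Real.sqrt_div hE0]
    field_simp
    rw [Real.sq_sqrt (by positivity : (0 : ℝ) ≤ R ^ 3)]
    ring
  have e2 : (R ^ 2)⁻¹ * (Real.sqrt (V₁ * R ^ 3) * Real.sqrt W) = Real.sqrt V₁ * Real.sqrt (W / R) := by
    have hR3 : Real.sqrt (R ^ 3) = R * Real.sqrt R := by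
      rw [show R ^ 3 = R ^ 2 * R by ring, Real.sqrt_mul (by positivity), Real.sqrt_sq hR.le]
    have hs : Real.sqrt R * Real.sqrt R = R := Real.mul_self_sqrt hR.le
    have hs0 : 0 < Real.sqrt R := Real.sqrt_pos.mpr hR
    rw [Real.sqrt_mul hV₁0, hR3, Real.sqrt_div hW0]
    field_simp
    rw [Real.sq_sqrt hR.le]
    ring
  calc ‖v y - biotSavart (cutVorticity v y R) y‖
      ≤ C * ((R ^ 3)⁻¹ * (∫ x in ball y R, ‖v x‖) + (R ^ 2)⁻¹ * (∫ x in ball y R, ‖curl v x‖)) :=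
        hC v hv hdiv y R hR
    _ ≤ C * ((R ^ 3)⁻¹ * (Real.sqrt (V₁ * R ^ 3) * Real.sqrt E)
          + (R ^ 2)⁻¹ * (Real.sqrt (V₁ * R ^ 3) * Real.sqrt W)) := by
        have h3 : (0 : ℝ) ≤ (R ^ 3)⁻¹ := by positivity
        have h2 : (0 : ℝ) ≤ (R ^ 2)⁻¹ := by positivity
        have hIv' : (R ^ 3)⁻¹ * (∫ x in ball y R, ‖v x‖) ≤ (R ^ 3)⁻¹ * (Real.sqrt (V₁ * R ^ 3) * Real.sqrt E) :=
          mul_le_mul_of_nonneg_left hIv h3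
        have hIw' : (R ^ 2)⁻¹ * (∫ x in ball y R, ‖curl v x‖) ≤
            (R ^ 2)⁻¹ * (Real.sqrt (V₁ * R ^ 3) * Real.sqrt W) :=
          mul_le_mul_of_nonneg_left hIw h2
        exact mul_le_mul_of_nonneg_left (add_le_add hIv' hIw') hC0
    _ = (C * Real.sqrt V₁) * (Real.sqrt (E / R ^ 3) + Real.sqrt (W / R)) := by rw [e1, e2]; ring
    _ ≤ max 1 (C * Real.sqrt V₁) * (Real.sqrt (E / R ^ 3) + Real.sqrt (W / R)) := by
        gcongr; exact le_max_right _ _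

set_option maxHeartbeats 400000 in
/-- **Sb by kernel.**  The `(Γ₂, ρ, δ)` choice of the Sb docstring, done once over H1/H2. -/
theorem vorticalCentre_of_stubs (h₁ : HelmholtzNearField) (h₂ : HarmonicRemainder) : VorticalCentre := by
  obtain ⟨C₁, hC₁, h₁⟩ := h₁
  obtain ⟨C₂, hC₂, h₂⟩ := h₂
  intro ε M₁ C₀ hε hM₁
  have hC₁0 : 0 < C₁ := by linarith
  have hC₂0 : 0 < C₂ := by linarith
  have hM₁0 : 0 < M₁ := by linarith
  -- the parameters
  set S : ℝ := Real.sqrt |C₀| with hSdef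
  have hS0 : 0 ≤ S := Real.sqrt_nonneg _
  set Γ₂ : ℝ := 3 + 4 * C₂ * S / ε with hΓ₂def
  have hΓ₂3 : 3 ≤ Γ₂ := by
    have : 0 ≤ 4 * C₂ * S / ε := by positivity
    linarith
  have hΓ₂0 : 0 < Γ₂ := by linarith
  set ρ₀ : ℝ := min 1 (ε / (4 * C₁ * M₁)) with hρ₀def
  have hρ₀0 : 0 < ρ₀ := lt_min one_pos (by positivity)
  have hρ₀1 : ρ₀ ≤ 1 := min_le_left _ _
  have hρ₀ε : ρ₀ ≤ ε / (4 * C₁ * M₁) := min_le_right _ _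
  -- `δ` is chosen LAST: it absorbs `Γ₂³` (far field of H1 at radius `R = Γ₂σ`) and `ρ₀⁻⁴`
  set q : ℝ := ε * ρ₀ ^ 2 / (4 * (C₁ + C₂)) with hqdef
  have hq0 : 0 < q := by positivity
  set δ : ℝ := q ^ 2 / Γ₂ ^ 3 with hδdef
  have hδ0 : 0 < δ := by positivity
  refine ⟨Γ₂, δ, by linarith, hδ0, ?_⟩
  intro v y σ hσ hv hdiv hC2 hE hhot
  -- radii
  set R : ℝ := Γ₂ * σ with hRdef
  have hR0 : 0 < R := mul_pos hΓ₂0 hσ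
  set ρ : ℝ := σ * ρ₀ with hρdef
  have hρ0 : 0 < ρ := mul_pos hσ hρ₀0
  have hρσ : ρ ≤ σ := by
    have : σ * ρ₀ ≤ σ * 1 := by gcongr
    simpa [hρdef] using this
  have h3ρR : 3 * ρ ≤ R := by
    have : 3 * σ ≤ Γ₂ * σ := by gcongr
    linarith
  have hρR : ρ ≤ R := by linarith
  -- contradiction hypothesis: small enstrophy `W = δ/σ`
  by_contra hnot
  have hWle : ∫⁻ x in ball y (Γ₂ * σ), ‖curl v x‖ₑ ^ 2 ≤ ENNReal.ofReal (δ / σ) := le_of_lt (not_le.mp hnot)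
  have hW0 : 0 ≤ δ / σ := by positivity
  -- energy with `|C₀|`
  have hE' : ∫⁻ x in ball y (Γ₂ * σ), ENNReal.ofReal (‖v x‖ ^ 2) ≤ ENNReal.ofReal (|C₀| * (Γ₂ * σ)) :=
    hE.trans (ENNReal.ofReal_le_ofReal (mul_le_mul_of_nonneg_right (le_abs_self C₀) hR0.le))
  have hE0 : 0 ≤ |C₀| * (Γ₂ * σ) := by positivity
  -- the first-derivative bound on `B(y,ρ) ⊆ B(y,σ)` from the `C²` hypothesis at `j = 1`
  set L : ℝ := M₁ * σ ^ (-(((1 : ℕ) : ℝ) + 1)) with hLdef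
  have hL : ∀ x ∈ ball y ρ, ‖iteratedFDeriv ℝ 1 v x‖ ≤ L := fun x hx =>
    hC2 x (ball_subset_ball hρσ hx) 1 (by norm_num)
  have hLval : L = M₁ / σ ^ 2 := by
    have : σ ^ (-(((1 : ℕ) : ℝ) + 1)) = (σ ^ 2)⁻¹ := by
      rw [show (-(((1 : ℕ) : ℝ) + 1)) = -(2 : ℝ) by norm_num, Real.rpow_neg hσ.le, Real.rpow_two]
    rw [hLdef, this, div_eq_mul_inv]
  -- H1 and H2 at the centre
  have hnear := h₁ v hv y ρ R L (δ / σ) hρ0 h3ρR hL hWle hW0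
  have hrem := h₂ v hv hdiv y R (|C₀| * (Γ₂ * σ)) (δ / σ) hR0 hE' hE0 hWle hW0
  -- term 1: `C₁ ρ L ≤ ε/(4σ)`
  have hT1 : C₁ * (ρ * L) ≤ ε / (4 * σ) := by
    rw [hLval, hρdef]
    have hσ2 : 0 < σ ^ 2 := by positivity
    have hkey : C₁ * ρ₀ * M₁ ≤ ε / 4 := by
      calc C₁ * ρ₀ * M₁ ≤ C₁ * (ε / (4 * C₁ * M₁)) * M₁ := by gcongr
        _ = ε / 4 := by field_simp
    rw [show C₁ * (σ * ρ₀ * (M₁ / σ ^ 2)) = C₁ * ρ₀ * M₁ / σ by field_simp]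
    rw [div_le_div_iff₀ hσ (by positivity)]
    nlinarith [hkey, hσ]
  -- term 2: `C₂ √(E/R³) ≤ ε/(4σ)` by the choice of `Γ₂`
  have hT2 : C₂ * Real.sqrt (|C₀| * (Γ₂ * σ) / R ^ 3) ≤ ε / (4 * σ) := by
    have hq : |C₀| * (Γ₂ * σ) / R ^ 3 = (S / R) ^ 2 := by
      rw [div_pow, Real.sq_sqrt (abs_nonneg C₀), hRdef]
      field_simp
    rw [hq, Real.sqrt_sq (by positivity)]
    have hΓε : ε * Γ₂ = 3 * ε + 4 * C₂ * S := by
      rw [hΓ₂def]; field_simp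
    rw [hRdef, show C₂ * (S / (Γ₂ * σ)) = C₂ * S / (Γ₂ * σ) by ring,
      div_le_div_iff₀ (by positivity) (by positivity)]
    nlinarith [hΓε, hσ, hε, hC₂0, hS0]
  -- term 3: H1's far field `C₁ √(R³W)/ρ² = C₁ q/((C₁+C₂)… )`: `√(R³·δ/σ) = σ q`, `/ρ² = q/(ρ₀²σ)`
  have hfar : Real.sqrt (R ^ 3 * (δ / σ)) / ρ ^ 2 = ε / (4 * (C₁ + C₂) * σ) := by
    have h1 : R ^ 3 * (δ / σ) = (σ * q) ^ 2 := by
      rw [hδdef, hRdef]; field_simp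
    rw [h1, Real.sqrt_sq (by positivity), hρdef, hqdef]
    field_simp
  -- term 4: H2's enstrophy term `C₂ √(W/R) = C₂ q/(Γ₂²σ) ≤ C₂ ε/(4(C₁+C₂)σ)`
  have hWR : Real.sqrt (δ / σ / R) = q / (Γ₂ ^ 2 * σ) := by
    have h1 : δ / σ / R = (q / (Γ₂ ^ 2 * σ)) ^ 2 := by
      rw [hδdef, hRdef]; field_simp
    rw [h1, Real.sqrt_sq (by positivity)]
  have hWR' : q / (Γ₂ ^ 2 * σ) ≤ ε / (4 * (C₁ + C₂) * σ) := by
    have hΓsq : (1 : ℝ) ≤ Γ₂ ^ 2 := one_le_pow₀ (by linarith)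
    have hρ₀sq : ρ₀ ^ 2 ≤ 1 := pow_le_one₀ hρ₀0.le hρ₀1
    have hqle : q ≤ ε / (4 * (C₁ + C₂)) :=
      calc q = ε * ρ₀ ^ 2 / (4 * (C₁ + C₂)) := hqdef
        _ ≤ ε * 1 / (4 * (C₁ + C₂)) := by gcongr
        _ = ε / (4 * (C₁ + C₂)) := by rw [mul_one]
    have hden : σ ≤ Γ₂ ^ 2 * σ := le_mul_of_one_le_left hσ.le hΓsq
    calc q / (Γ₂ ^ 2 * σ) ≤ q / σ := div_le_div_of_nonneg_left hq0.le hσ hden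
      _ ≤ (ε / (4 * (C₁ + C₂))) / σ := by gcongr
      _ = ε / (4 * (C₁ + C₂) * σ) := by rw [div_div]
  have hT34 : C₁ * (Real.sqrt (R ^ 3 * (δ / σ)) / ρ ^ 2) + C₂ * Real.sqrt (δ / σ / R) ≤ ε / (4 * σ) := by
    rw [hfar, hWR]
    calc C₁ * (ε / (4 * (C₁ + C₂) * σ)) + C₂ * (q / (Γ₂ ^ 2 * σ))
        ≤ C₁ * (ε / (4 * (C₁ + C₂) * σ)) + C₂ * (ε / (4 * (C₁ + C₂) * σ)) := by gcongr
      _ = ε / (4 * σ) := by field_simp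
  -- assemble
  have hvy : ‖v y‖ ≤ ε / (4 * σ) + ε / (4 * σ) + ε / (4 * σ) := by
    have hsplit : ‖v y‖ ≤ ‖v y - biotSavart (cutVorticity v y R) y‖ + ‖biotSavart (cutVorticity v y R) y‖ := by
      calc ‖v y‖ = ‖(v y - biotSavart (cutVorticity v y R) y) + biotSavart (cutVorticity v y R) y‖ := by
            rw [sub_add_cancel]
        _ ≤ _ := norm_add_le _ _
    have h1' : ‖biotSavart (cutVorticity v y R) y‖ ≤
        C₁ * (ρ * L) + C₁ * (Real.sqrt (R ^ 3 * (δ / σ)) / ρ ^ 2) := by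
      have := hnear; rw [mul_add] at this; exact this
    have h2' : ‖v y - biotSavart (cutVorticity v y R) y‖ ≤
        C₂ * Real.sqrt (|C₀| * (Γ₂ * σ) / R ^ 3) + C₂ * Real.sqrt (δ / σ / R) := by
      have := hrem; rw [mul_add] at this; exact this
    linarith [hsplit, h1', h2', hT1, hT2, hT34]
  have hfin : σ * ‖v y‖ ≤ ε := by
    calc σ * ‖v y‖ ≤ σ * (ε / (4 * σ) + ε / (4 * σ) + ε / (4 * σ)) := by gcongr
      _ = 3 * ε / 4 := by field_simp; ring
      _ ≤ ε := by linarith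
  linarith [hhot, hfin]

/-- Sb from H2 alone (v1.1). -/
theorem vorticalCentre_of_harmonicRemainder (h₂ : HarmonicRemainder) : VorticalCentre :=
  vorticalCentre_of_stubs helmholtzNearField_holds h₂

/-- Sb from H2♭ alone (v1.2): the whole line modulo ONE shell-kernel estimate. -/
theorem vorticalCentre_of_shellKernelBound (h : ShellKernelBound) : VorticalCentre :=
  vorticalCentre_of_stubs helmholtzNearField_holds (harmonicRemainder_of_shellKernelBound h)

/-- E2 of record (`EmberCensus.TerminalEmber`) ⟸ Sa `RegularAftermath`, H2♭ `ShellKernelBound`, Sc′ `ThickBoxSilencingCost`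
(+ the tree kernel's own Sd): tree `SilencingCost.terminalEmber_of_aftermath_of_vortical_of_thickBox` with Sb discharged. -/
theorem terminalEmber_of_aftermath_of_shellKernel_of_thickBox (hA : RegularAftermath) (h : ShellKernelBound)
    (hS : ThickBoxSilencingCost) : TerminalEmber :=
  SilencingCost.terminalEmber_of_aftermath_of_vortical_of_thickBox hA (vorticalCentre_of_shellKernelBound h) hS

/-- E2 of record through the smooth_silence branch ⟸ Sa♯, H2♭, Sc♮, Sd: tree `SmoothSilence.terminalEmber_of_sharp`
with Sb discharged. -/
theorem terminalEmber_of_sharp_of_shellKernel (hA : SharpAftermath) (h : ShellKernelBound)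
    (hP : SharpEnstrophyPersistence) (hD : SilencingCost.EmberReadout) : TerminalEmber :=
  SmoothSilence.terminalEmber_of_sharp hA (vorticalCentre_of_shellKernelBound h) hP hD

end Summit.NavierStokesRegularity.NavierStokesRegularity.Cruxes.TypeIQuantSubcubicExp.HelmholtzCentre

end
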